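import Summits.AnomalousDissipation.AnomalousDissipation.Theorems.BaireTransferRobustLoudUpgradeLineScalingDefs
import Summits.AnomalousDissipation.AnomalousDissipation.Theorems.BaireTransferRobustLoudUpgradeStubUnfoldingPersist
import Summits.AnomalousDissipation.AnomalousDissipation.Theorems.BaireTransferRobustLoudUpgradeStubSteadyWindowNear

/-!
# Line `malkin-cone-group-orbits`, COMPANION skeleton c5 (lead `…-1144-c5-0`) for the crux `BaireTransfer.RobustLoudUpgrade`
# (stmt-AnomalousDissipation-1144): THE INTRINSIC UNFOLDING, SOLVED NOT SWEPT — skeleton v2 (after wave 1)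

Companion of the generation-1 skeleton v5 (`Lines/malkin_cone_group_orbits.lean`), of c1 (`…_c1.lean`), c2 (`…_c2.lean`),
c3 (`…_c3.lean`) and c4 (`…_c4.lean`).  This file does NOT reshape those skeletons; its stubs were registered ADDITIVELY.
State after wave 1 (2026-08-16T23:4xZ) — EVERY registered stub of this companion except the residual is LANDED:

* `stub_unfoldingPersist` (lead, hardest; the bordered IFT on the drifted Fourier lattice along the intrinsic unfolding
  `(ν, m) ↦ (ν − rα, m + r·dir)`, any mean): `Unfolding.stub_unfoldingPersist` p130983 (`…StubUnfoldingPersist.lean`), resting on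
  `Unfolding.unfoldingPersist_partA` p130399 (`…StubUnfoldingPersistA.lean`: border coefficients, Parseval with a zero mode, drifted
  synthesis, lattice `H¹` distance) and the new Literature engine `Literature.Analysis.Calculus.bordered_unfolding_persistence` p130110
  (`Literature/Analysis/Calculus/BorderedUnfoldingPersistence.lean`: bordered IFT with a state-dependent border);
* `stub_steadyWindowNear` (window, any mean, moving viscosity): `SteadyWindowNear.stub_steadyWindowNear` p129964;
* definitions + glue `…LineUnfoldingDefs.lean` (`SteadyPersistsNear`, `persistSteadyNear`, `unfoldSteady`, `tameUnfold`,
  `unfoldSteady ⊆ persistSteadyNear ⊆ interior loud`, `tameUnfold ⊆ closure (interior loud)`, registered `line_glue_c5`) — SUBMITTED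
  p131399 (review-queued: new definitions); until it lands this skeleton carries the same definitions and glue inline (§1–§2 below are
  that file verbatim), fed by the LANDED analytic stubs.

Open: `stub_residual_c5` (crux-sized; the c4 residual `stub_residual_c4` over `tameScaling` implies it, `residual_c5_of_c4`).
-/

set_option linter.dupNamespace false

noncomputable section

open scoped BigOperators Topology
open Filter Set Function TopologicalSpace MeasureTheory

namespace Summit.AnomalousDissipation.AnomalousDissipation.Theorems.RobustLoudUpgrade

open Literature.Analysis.FunctionSpaces Literature.Analysis.FunctionSpaces.Torus
open Literature.Analysis.FluidPDE
open Summit.AnomalousDissipation.AnomalousDissipation.Theses.BaireTransfer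

namespace Unfolding

/-! ## §1 The classes of the companion c5 -/

/-- **Persistence NEAR a steady state, viscosity and mean free**: for every `δ > 0` all forces `f_{c'}`, `c'` near `c`, carry a
classical steady state `u'` of `NS_{ν'}` for some `ν'` with `|ν' − ν| < δ`, within squared `H¹`-distance `δ` of `u₀` (the
conclusion of `Unfolding.stub_unfoldingPersist`; compare `SteadyPersistsAt` (same `ν`, mean zero) and `SteadyPersistsInLeaf` (same
`ν`, same mean)). [folklore] -/
@[folklore] def SteadyPersistsNear (S : Finset (Fin 3 → ℤ)) (c : Coeff S) (ν : ℝ)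
    (u₀ : UnitAddTorus (Fin 3) → EuclideanSpace ℝ (Fin 3)) : Prop :=
  ∀ δ : ℝ, 0 < δ → ∃ r : ℝ, 0 < r ∧ ∀ c' : Coeff S, dist c' c < r →
    ∃ (ν' : ℝ) (u' : UnitAddTorus (Fin 3) → EuclideanSpace ℝ (Fin 3)) (p' : UnitAddTorus (Fin 3) → ℝ),
      |ν' - ν| < δ ∧ Torus.IsSteadyNSState ν' (force S c') u' p' ∧ h1DistSq u' u₀ < δ

/-- **Near-persistent loud steady witnesses** (any mean; viscosity free): a classical steady witness with strict budgets that
persists in the sense of `SteadyPersistsNear`. [folklore] -/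
def persistSteadyNear (S : Finset (Fin 3 → ℤ)) (a E ε : ℝ) : Set (Coeff S) :=
  {c | ∃ ν : ℝ, 0 < ν ∧ ν < a ∧ ∃ (u₀ : UnitAddTorus (Fin 3) → EuclideanSpace ℝ (Fin 3)) (p₀ : UnitAddTorus (Fin 3) → ℝ),
    Torus.IsSteadyNSState ν (force S c) u₀ p₀ ∧ meanEnergy (fun _ : ℝ => u₀) < E ∧
      ε < meanDissipation ν (fun _ : ℝ => u₀) ∧ SteadyPersistsNear S c ν u₀}

/-- **Intrinsically visible simply degenerate steady witnesses** (class U of the companion c5): a classical steady witness of ANY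
mean with strict budgets, whose classical mean-zero kernel lies on one complex line `ℂ·v`, and for which an INTRINSIC border
`αΔu₀ + ∑ᵢ dirᵢ ∂ᵢu₀` — a generator of the viscosity (`Δu₀`) and Galilean-drift (`∂ᵢu₀`) unfoldings — is first-order visible,
`∉ range L(ν,u₀)`.  Contains c4's radially visible class (every leaf) and the drift-visible degeneracies. [folklore] -/
def unfoldSteady (S : Finset (Fin 3 → ℤ)) (a E ε : ℝ) : Set (Coeff S) :=
  {c | ∃ ν : ℝ, 0 < ν ∧ ν < a ∧ ∃ (u₀ : UnitAddTorus (Fin 3) → EuclideanSpace ℝ (Fin 3)) (p₀ : UnitAddTorus (Fin 3) → ℝ),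
    Torus.IsSteadyNSState ν (force S c) u₀ p₀ ∧ meanEnergy (fun _ : ℝ => u₀) < E ∧
      ε < meanDissipation ν (fun _ : ℝ => u₀) ∧
      ∃ v : UnitAddTorus (Fin 3) → EuclideanSpace ℝ (Fin 3), IsSmooth v ∧ IsDivFree v ∧ HasZeroMean v ∧
        (∀ w, Torus.LinNSResolventRel ν u₀ 0 w 0 → ∃ z : ℂ, w = z • cplx v) ∧
        ∃ (α : ℝ) (dir : Fin 3 → ℤ),
          ∀ w, ¬ Torus.LinNSResolventRel ν u₀ 0 w
            (cplx (fun x => α • laplacian u₀ x + ∑ i, (dir i : ℝ) • partialDeriv i u₀ x))}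

/-- The tame union of the companion c5: c4's `tameScaling` plus the near-persistent and the intrinsically visible steady
classes. [folklore] -/
def tameUnfold (S : Finset (Fin 3 → ℤ)) (a E ε : ℝ) : Set (Coeff S) :=
  tameScaling S a E ε ∪ persistSteadyNear S a E ε ∪ unfoldSteady S a E ε

/-! ## §2 Glue (sorry-free): the classes are force-OPEN; the residual over `tameUnfold` proves the crux BY NAME -/

/-- `unfoldSteady ⊆ persistSteadyNear` (the landed `Unfolding.stub_unfoldingPersist`). [folklore] -/
theorem unfoldSteady_subset_persistSteadyNear (S : Finset (Fin 3 → ℤ)) (a E ε : ℝ) :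
    unfoldSteady S a E ε ⊆ persistSteadyNear S a E ε := by
  intro c hc
  obtain ⟨ν, hν, hνa, u₀, p₀, hst, hE, hε, v, hv₁, hv₂, hv₃, hker, α, dir, hvis⟩ := hc
  exact ⟨ν, hν, hνa, u₀, p₀, hst, hE, hε,
    stub_unfoldingPersist S c ν u₀ p₀ v α dir hν hst hv₁ hv₂ hv₃ hker hvis⟩

/-- `persistSteadyNear ⊆ interior LOUD` at the same strict budgets (the landed `SteadyWindowNear.stub_steadyWindowNear`).
[folklore] -/
theorem persistSteadyNear_subset_interior_loud (S : Finset (Fin 3 → ℤ)) (a E ε : ℝ) :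
    persistSteadyNear S a E ε ⊆ interior (loud S a E ε) := by
  intro c hc
  obtain ⟨ν, hν, hνa, u₀, p₀, hst, hE, hε, hpers⟩ := hc
  exact SteadyWindowNear.stub_steadyWindowNear S a E ε c ν u₀ p₀ hν hνa hst hE hε hpers

/-- **(U)** `unfoldSteady ⊆ interior LOUD`: an intrinsically visible simply degenerate steady witness of any mean is an
INTERIOR point of the loud set. [folklore] -/
theorem unfoldSteady_subset_interior_loud (S : Finset (Fin 3 → ℤ)) (a E ε : ℝ) :
    unfoldSteady S a E ε ⊆ interior (loud S a E ε) :=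
  (unfoldSteady_subset_persistSteadyNear S a E ε).trans (persistSteadyNear_subset_interior_loud S a E ε)

/-- **The tame union of the companion c5 is force-open up to closure.** [folklore] -/
theorem tameUnfold_subset_closure_interior_loud (S : Finset (Fin 3 → ℤ)) (a E ε : ℝ) :
    tameUnfold S a E ε ⊆ closure (interior (loud S a E ε)) :=
  Set.union_subset
    (Set.union_subset (ScalingCrossing.tameScaling_subset_closure_interior_loud S a E ε)
      ((persistSteadyNear_subset_interior_loud S a E ε).trans subset_closure))
    ((unfoldSteady_subset_interior_loud S a E ε).trans subset_closure)

/-- **Line glue of the companion c5 (registered sub-goal `line_glue_c5`)**: the residual over `tameUnfold` proves the crux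
`RobustLoudUpgrade` BY NAME (`LsCrossing.RobustLoudUpgrade_of_residual`). [folklore] -/
theorem line_glue_c5 : (∀ S : Finset (Fin 3 → ℤ), unitStock ⊆ S → ∀ (a E ε : ℝ), 0 < a → 0 < ε → loud S a E ε ⊆ closure (tameUnfold S a (2 * E) (ε / 2))) → RobustLoudUpgrade :=
  fun hRes => LsCrossing.RobustLoudUpgrade_of_residual (fun S a E ε => tameUnfold S a E ε)
    tameUnfold_subset_closure_interior_loud hRes

/-! ## §3 The one open stub: the residual (crux-sized) -/

/-- **stub_residual_c5** (the residual of the companion c5; crux-sized = `stub_residual_c4` with the intrinsically visible and the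
near-persistent steady witnesses of every mean moved to the tame side).  Open content: steady ghosts invisible from
`P_S ⊕ ℝΔu₀ ⊕ ℝ³∇u₀`, kernels of dimension ≥ 2 beyond the four intrinsic borders, degenerate periodic orbits not unfolded by
force/period/viscosity, non-periodic recurrence — the finite-family Kupka–Smale problem of the route card. [folklore] -/
theorem stub_residual_c5 :
    ∀ S : Finset (Fin 3 → ℤ), unitStock ⊆ S → ∀ (a E ε : ℝ), 0 < a → 0 < ε →
      loud S a E ε ⊆ closure (tameUnfold S a (2 * E) (ε / 2)) := by
  sorry

/-- The reshape c4 → c5 only WEAKENS the residual: the c4 residual over `tameScaling` implies the c5 residual. [folklore] -/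
theorem residual_c5_of_c4
    (h : ∀ S : Finset (Fin 3 → ℤ), unitStock ⊆ S → ∀ (a E ε : ℝ), 0 < a → 0 < ε →
      loud S a E ε ⊆ closure (tameScaling S a (2 * E) (ε / 2))) :
    ∀ S : Finset (Fin 3 → ℤ), unitStock ⊆ S → ∀ (a E ε : ℝ), 0 < a → 0 < ε →
      loud S a E ε ⊆ closure (tameUnfold S a (2 * E) (ε / 2)) :=
  fun S hS a E ε ha hε => (h S hS a E ε ha hε).trans
    (closure_mono (Set.subset_union_left.trans Set.subset_union_left))

/-! ## §4 Composition (sorry-free): the crux BY NAME -/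

/-- **Composition (companion c5): the registered stubs prove the crux `RobustLoudUpgrade` BY NAME** — `line_glue_c5` applied to
the residual. [folklore] -/
theorem RobustLoudUpgrade_of : RobustLoudUpgrade :=
  line_glue_c5 stub_residual_c5

end Unfolding

end Summit.AnomalousDissipation.AnomalousDissipation.Theorems.RobustLoudUpgrade

end
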